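import Summits.SmoothPoincare4.SmoothPoincare4.Theses.SymplecticCap
import Summits.SmoothPoincare4.SmoothPoincare4.Theorems.SymplecticOrigamiGromovRecognitionRelEndOfFacts

/-!
# Split seam of the crux `GromovRecognitionRelEnd` (item stmt-SmoothPoincare4-11009, route SymplecticCap)

The strategist's BC2-redirect decomposition (`Cruxes/GromovRecognitionRelEnd/SPLIT-bc2.md` §1):

    GromovRecognitionRelEnd  ⇐  X₁ ∧ X₂ ∧ X₃ ∧ X₄,   X₄ := (X₁ → X₂ → X₃ → GromovRecognitionRelEnd)

with `X₁ = AdjunctionEmbeddedSpheres` (item stmt-SmoothPoincare4-16775, Wendl 2018 Cor. 2.52),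
`X₂ = LocalFoliationEmbeddedSpheres` (stmt-16778, Hofer–Lizan–Sikorav 1997 / Wendl Prop. 2.53),
`X₃ = GromovCompactnessSpheres` (stmt-16777, Gromov 1985 1.5.B / McDuff–Salamon 2012 Thm. 5.3.1) and the
bridge `X₄ = GromovRecognitionRelEndOfJCurveFacts` (stmt-16773).  This file lands

* the ASSEMBLY `GromovRecognitionRelEnd_of_subs : X₁ → X₂ → X₃ → X₄ → GromovRecognitionRelEnd` (modus
  ponens; registered on the crux as `helper_cruxOfSubs`) — the term the route split cites with
  `--glue-by`; and
* the BRIDGE ITSELF from the line `cross-cap-laurent`: `GromovRecognitionRelEndOfJCurveFacts_of_line : X₄`,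
  i.e. `X₁ → X₂ → X₃ → GromovRecognitionRelEnd` UNCONDITIONALLY — it is the landed conditional composition
  `GromovRecognitionRelEnd_cap_of_facts : F1 → F2 → F4 → GromovRecognitionRelEnd`
  (SymplecticOrigamiGromovRecognitionRelEndOfFacts.lean, p145274) with its arguments permuted, because the
  three route decls `X₂, X₃, X₁` are the Literature named facts F1, F2, F4 verbatim (definitionally).

Consequently the crux is reduced, kernel-checked, to exactly the three J-curve facts:
`GromovRecognitionRelEnd_of_three : X₁ → X₂ → X₃ → GromovRecognitionRelEnd`.
No new definitions, no `sorry`; everything here is pure logic over landed theorems.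
-/

-- the prescribed namespace `Summit.<P>.<Sub>.…` duplicates `SmoothPoincare4` (P = Sub)
set_option linter.dupNamespace false

namespace Summit.SmoothPoincare4.SmoothPoincare4.Theorems

open Summit.SmoothPoincare4.SmoothPoincare4.Theses.SymplecticCap

namespace GromovRecognitionRelEnd.CrossCapLaurent

/-- **Registered helper `helper_cruxOfSubs` — the split assembly (modus ponens).**  From the three
J-curve facts `X₁ X₂ X₃` and the bridge `X₄ : X₁ → X₂ → X₃ → GromovRecognitionRelEnd`, the crux. -/
theorem helper_cruxOfSubs :
    Summit.SmoothPoincare4.SmoothPoincare4.Theses.SymplecticCap.AdjunctionEmbeddedSpheres →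
    Summit.SmoothPoincare4.SmoothPoincare4.Theses.SymplecticCap.LocalFoliationEmbeddedSpheres →
    Summit.SmoothPoincare4.SmoothPoincare4.Theses.SymplecticCap.GromovCompactnessSpheres →
    Summit.SmoothPoincare4.SmoothPoincare4.Theses.SymplecticCap.GromovRecognitionRelEndOfJCurveFacts →
    Summit.SmoothPoincare4.SmoothPoincare4.Theses.SymplecticCap.GromovRecognitionRelEnd :=
  fun h₄ h₁ h₂ hbridge => hbridge h₄ h₁ h₂

/-- **The bridge `X₄` holds, by the line `cross-cap-laurent`:** `AdjunctionEmbeddedSpheres →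
LocalFoliationEmbeddedSpheres → GromovCompactnessSpheres → GromovRecognitionRelEnd` is the landed
conditional composition `GromovRecognitionRelEnd_cap_of_facts` (F1 → F2 → F4 → crux) with permuted
arguments — the route decls are the Literature facts `adjunction_embedded_of_somewhereInjective_sphere`,
`hls_localFoliation_embeddedSphere_trivialNormal`, `gromovCompactness_spheres_dichotomy` verbatim. -/
theorem GromovRecognitionRelEndOfJCurveFacts_of_line :
    Summit.SmoothPoincare4.SmoothPoincare4.Theses.SymplecticCap.GromovRecognitionRelEndOfJCurveFacts :=
  fun h₄ h₁ h₂ => GromovRecognitionRelEnd_cap_of_facts h₁ h₂ h₄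

end GromovRecognitionRelEnd.CrossCapLaurent

/-- **Split assembly of the crux `GromovRecognitionRelEnd`** (the name the route split cites):
`X₁ → X₂ → X₃ → X₄ → GromovRecognitionRelEnd`, modus ponens. -/
theorem GromovRecognitionRelEnd_of_subs :
    Summit.SmoothPoincare4.SmoothPoincare4.Theses.SymplecticCap.AdjunctionEmbeddedSpheres →
    Summit.SmoothPoincare4.SmoothPoincare4.Theses.SymplecticCap.LocalFoliationEmbeddedSpheres →
    Summit.SmoothPoincare4.SmoothPoincare4.Theses.SymplecticCap.GromovCompactnessSpheres →
    Summit.SmoothPoincare4.SmoothPoincare4.Theses.SymplecticCap.GromovRecognitionRelEndOfJCurveFacts →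
    Summit.SmoothPoincare4.SmoothPoincare4.Theses.SymplecticCap.GromovRecognitionRelEnd :=
  GromovRecognitionRelEnd.CrossCapLaurent.helper_cruxOfSubs

/-- **The crux from the three J-curve facts alone** (assembly ∘ bridge): once items 16775, 16778 and
16777 are proved, `GromovRecognitionRelEnd_of_three X₁_holds X₂_holds X₃_holds` closes stmt-11009. -/
theorem GromovRecognitionRelEnd_of_three :
    Summit.SmoothPoincare4.SmoothPoincare4.Theses.SymplecticCap.AdjunctionEmbeddedSpheres →
    Summit.SmoothPoincare4.SmoothPoincare4.Theses.SymplecticCap.LocalFoliationEmbeddedSpheres →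
    Summit.SmoothPoincare4.SmoothPoincare4.Theses.SymplecticCap.GromovCompactnessSpheres →
    Summit.SmoothPoincare4.SmoothPoincare4.Theses.SymplecticCap.GromovRecognitionRelEnd :=
  fun h₄ h₁ h₂ => GromovRecognitionRelEnd_of_subs h₄ h₁ h₂
    GromovRecognitionRelEnd.CrossCapLaurent.GromovRecognitionRelEndOfJCurveFacts_of_line

end Summit.SmoothPoincare4.SmoothPoincare4.Theorems
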